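import Mathlib.Analysis.Calculus.FDeriv.Mul
import Mathlib.Analysis.Calculus.ContDiff.Operations
import Literature.Barriers.CriticalPhenomena.RigorousRGSmallParameterTphiSeminorm
import HarnessLib

/-!
# `RigorousRGSmallParameter` (Slade, Theorem 1.4.1): the `T_φ` seminorm of [BS-rg-norm] —
# II. The algebra `𝒩`, the coefficients `F_z(φ)`, and Proposition 3.4.5 (product property)

Sequel of `RigorousRGSmallParameterTphiSeminorm.lean` (see there for the sources and the overall
architecture). [BS-rg-norm] §2.1: "Let `ℛ = ℛ(𝚲_b)` denote the ring of smooth functions from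
`ℝ^{𝚲_b}` to `ℂ`" — here real-valued and `C^∞`, on an arbitrary real normed space `E` of fields
with a family of coordinate directions `e : 𝚲 → E` (for Slade: `E = (ℝⁿ)^Λ`, `e_{(x,i)}` the unit
vectors) — and §3.4, display (Fxyphi): `F_{x}(φ) = ∂^p F(φ)/∂φ_{x_p}⋯∂φ_{x_1}` (Slade (6.30):
`F_z(φ) = ∂^pF(φ)/∂φ^{i_1}_{x_1}⋯∂φ^{i_p}_{x_p}`), Definition 3.4.1 (the pairing
`⟨F,g⟩_φ = Σ_z (1/z!) F_z(φ)g_z` and `‖F‖_{T_φ} = sup_{g ∈ B(Φ)} |⟨F,g⟩_φ|`), Proposition 3.4.5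
("For `F, G ∈ 𝒩`, `‖FG‖_{T_φ} ≤ ‖F‖_{T_φ}‖G‖_{T_φ}`"), whose printed proof is: "Taylor expansion of
the coefficients … defines an algebra isomorphism of `𝒩` into a subalgebra of the algebra `ℋ` and,
in turn, `ℋ` is isomorphic as an algebra to `𝓕`. The composition of these isomorphisms is an
isometry of the semi-normed algebras `(𝒩,T_φ)` and `(𝓕,T)`, so Proposition 3.4.5 follows from
Proposition 5.1.2."

## What this file proves (everything; no named fact)

* `coeff e z F` — `F_z` as the iterated directional derivative along `e_{z_1}, …, e_{z_p}`;
  `contDiff_coeff`; **`coeff_eq_iteratedFDeriv`**: `F_z(φ) = D^{|z|}F(φ)(e_{z_1},…,e_{z_p})`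
  (so `F_z` is the mixed partial derivative, symmetric in `z`);
* **`coeff_mul`** — the Leibniz rule `(FG)_z = Σ_{(z',z'')∈S_z} F_{z'}G_{z''}`, i.e. the coefficient
  map `𝒩 → (𝓕, ⋆)` is multiplicative (`coeffFamily_mul`), and additive (`coeff_add`);
* `TphiPairing`, `TphiNorm` (Definition 3.4.1 relative to a family of test functionals) and
  **`TphiNorm_mul_le`** — Proposition 3.4.5 for every family of test functionals with the shuffle
  property and unit ball bounded on short sequences; `abs_TphiPairing_le`,
  `abs_apply_le_TphiNorm` (`|F(φ)| ≤ ‖F‖_{T_φ}`), `TphiNorm_add_le`, `TphiNorm_nonneg`.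

The lattice instance (Slade's `T_{φ,j}(𝔥_j)`) is `RigorousRGSmallParameterTestFunctionNorm.lean`.
-/

noncomputable section

namespace Literature.Barriers.CriticalPhenomena

namespace LongRangePhi4

namespace Tphi

open Finset

variable {Ξ : Type*}


/-! ## The algebra `𝒩` of smooth functions of the field and the `T_φ` seminorm -/

section calculus

open scoped ContDiff

variable {E : Type*} [NormedAddCommGroup E] [NormedSpace ℝ E]

/-- The directional derivative `∂_v F (φ) = DF(φ; v)`. [folklore] -/
def dirDeriv (v : E) (F : E → ℝ) : E → ℝ := fun φ => fderiv ℝ F φ v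

/-- The coefficient `F_z(φ) = ∂^p F(φ)/∂φ_{z_p} ⋯ ∂φ_{z_1}` of `F ∈ 𝒩` along a sequence
`z = (z_1, …, z_p)` of field labels, the label `x` standing for the coordinate direction `e x`
(display (Fxyphi) of [BS-rg-norm], bosonic case; Slade (6.30) `F_z(φ) = ∂^p F(φ)/∂φ^{i_1}_{x_1}⋯∂φ^{i_p}_{x_p}`).
[cite: BrydgesSlade2015RGI, §3.4 (display defining F_{x,y}(φ))] [cite: Slade2017, §6.2.2 (display defining F_z(φ))] -/
def coeff (e : Ξ → E) : List Ξ → (E → ℝ) → (E → ℝ)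
  | [], F => F
  | a :: z, F => dirDeriv (e a) (coeff e z F)

/-- `F_∅ = F`. [folklore] -/
@[simp] theorem coeff_nil (e : Ξ → E) (F : E → ℝ) : coeff e [] F = F := rfl

/-- `F_{a·z} = ∂_{e_a} F_z`. [folklore] -/
theorem coeff_cons (e : Ξ → E) (a : Ξ) (z : List Ξ) (F : E → ℝ) :
    coeff e (a :: z) F = dirDeriv (e a) (coeff e z F) := rfl

/-- A directional derivative of a smooth function is smooth. [folklore] -/
theorem contDiff_dirDeriv {F : E → ℝ} (hF : ContDiff ℝ ∞ F) (v : E) :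
    ContDiff ℝ ∞ (dirDeriv v F) := by
  have h := (contDiff_infty_iff_fderiv.1 hF).2
  exact h.clm_apply contDiff_const

/-- The coefficients `F_z` of a smooth `F` are smooth. [folklore] -/
theorem contDiff_coeff (e : Ξ → E) {F : E → ℝ} (hF : ContDiff ℝ ∞ F) :
    ∀ z : List Ξ, ContDiff ℝ ∞ (coeff e z F)
  | [] => hF
  | a :: z => contDiff_dirDeriv (contDiff_coeff e hF z) (e a)

/-- Smooth functions are differentiable. [folklore] -/
theorem differentiable_of_contDiff {F : E → ℝ} (hF : ContDiff ℝ ∞ F) : Differentiable ℝ F :=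
  hF.differentiable (by simp)

/-- `∂_v(F + G) = ∂_v F + ∂_v G`. [folklore] -/
theorem dirDeriv_add (v : E) {F G : E → ℝ} (hF : Differentiable ℝ F) (hG : Differentiable ℝ G) :
    dirDeriv v (fun φ => F φ + G φ) = fun φ => dirDeriv v F φ + dirDeriv v G φ := by
  funext φ
  simp only [dirDeriv]
  rw [fderiv_fun_add (hF φ) (hG φ)]
  rfl

/-- The Leibniz rule `∂_v(FG) = (∂_vF)G + F∂_vG`. [folklore] -/
theorem dirDeriv_mul (v : E) {F G : E → ℝ} (hF : Differentiable ℝ F) (hG : Differentiable ℝ G) :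
    dirDeriv v (fun φ => F φ * G φ) = fun φ => dirDeriv v F φ * G φ + F φ * dirDeriv v G φ := by
  funext φ
  simp only [dirDeriv]
  rw [fderiv_fun_mul (hF φ) (hG φ)]
  simp only [add_apply, smul_apply, smul_eq_mul]
  ring

/-- A list sum of differentiable functions is differentiable. [folklore] -/
theorem differentiable_list_sum {β : Type*} (l : List β) (f : β → E → ℝ)
    (hf : ∀ b ∈ l, Differentiable ℝ (f b)) :
    Differentiable ℝ (fun φ => (l.map fun b => f b φ).sum) := by
  induction l with
  | nil => simp
  | cons b l ih =>
    simp only [List.map_cons, List.sum_cons]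
    exact (hf b (by simp)).add (ih fun b' hb' => hf b' (by simp [hb']))

/-- `∂_v` of a list sum of differentiable functions is the sum of the `∂_v`'s. [folklore] -/
theorem dirDeriv_list_sum (v : E) {β : Type*} (l : List β) (f : β → E → ℝ)
    (hf : ∀ b ∈ l, Differentiable ℝ (f b)) :
    dirDeriv v (fun φ => (l.map fun b => f b φ).sum) = fun φ => (l.map fun b => dirDeriv v (f b) φ).sum := by
  induction l with
  | nil =>
    funext φ
    simp [dirDeriv]
  | cons b l ih =>
    have hl : ∀ b' ∈ l, Differentiable ℝ (f b') := fun b' hb' => hf b' (by simp [hb'])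
    simp only [List.map_cons, List.sum_cons]
    rw [dirDeriv_add v (hf b (by simp)) (differentiable_list_sum l f hl), ih hl]

/-- **Leibniz rule for the coefficients**: for `F, G ∈ 𝒩`,
`(FG)_z = Σ_{(z',z'') ∈ S_z} F_{z'} G_{z''}`, i.e. the coefficient map `F ↦ (F_z(φ))_z` is an
algebra homomorphism onto `(𝓕, ⋆)` — the isomorphism "`𝒩 → ℋ → 𝓕`" of the proof of
Proposition 3.4.5 of [BS-rg-norm] (bosonic case). [cite: BrydgesSlade2015RGI, §5.1 (Lemma 5.1.1 and the proof of Proposition 3.4.5)] -/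
theorem coeff_mul (e : Ξ → E) {F G : E → ℝ} (hF : ContDiff ℝ ∞ F) (hG : ContDiff ℝ ∞ G) :
    ∀ z : List Ξ, coeff e z (fun φ => F φ * G φ) =
      fun φ => ((splits z).map fun p => coeff e p.1 F φ * coeff e p.2 G φ).sum
  | [] => by
      funext φ
      simp
  | a :: z => by
      rw [coeff_cons, coeff_mul e hF hG z, dirDeriv_list_sum]
      · funext φ
        rw [sum_splits_cons]
        congr 1
        refine List.map_congr_left fun p _ => ?_
        rw [dirDeriv_mul _ (differentiable_of_contDiff (contDiff_coeff e hF p.1))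
          (differentiable_of_contDiff (contDiff_coeff e hG p.2))]
        rfl
      · intro p _
        exact (differentiable_of_contDiff (contDiff_coeff e hF p.1)).mul
          (differentiable_of_contDiff (contDiff_coeff e hG p.2))

/-- The coefficients are the mixed Fréchet derivatives: `F_z(φ) = D^{|z|}F(φ)(e_{z_1}, …, e_{z_p})`
(up to the order in which the directions are listed: `coeff` differentiates along `z_p` first).
[folklore] -/
theorem coeff_eq_iteratedFDeriv (e : Ξ → E) {F : E → ℝ} (hF : ContDiff ℝ ∞ F) :
    ∀ (z : List Ξ) (φ : E),
      coeff e z F φ = iteratedFDeriv ℝ z.length F φ (fun i => e (z.get i))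
  | [], φ => by simp
  | a :: z, φ => by
      rw [coeff_cons, dirDeriv]
      have ih : coeff e z F = fun ψ => iteratedFDeriv ℝ z.length F ψ (fun i => e (z.get i)) :=
        funext fun ψ => coeff_eq_iteratedFDeriv e hF z ψ
      rw [ih]
      have hd : DifferentiableAt ℝ (iteratedFDeriv ℝ z.length F) φ :=
        (hF.differentiable_iteratedFDeriv (WithTop.coe_lt_coe.2 (ENat.coe_lt_top _))) φ
      have happ : HasFDerivAt (fun ψ => iteratedFDeriv ℝ z.length F ψ (fun i => e (z.get i)))
          ((ContinuousMultilinearMap.apply ℝ (fun _ : Fin z.length => E) ℝ (fun i => e (z.get i))).comp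
            (fderiv ℝ (iteratedFDeriv ℝ z.length F) φ)) φ :=
        (ContinuousMultilinearMap.apply ℝ (fun _ : Fin z.length => E) ℝ
          (fun i => e (z.get i))).hasFDerivAt.comp φ hd.hasFDerivAt
      rw [happ.fderiv, ContinuousLinearMap.comp_apply, ContinuousMultilinearMap.apply_apply]
      show _ = iteratedFDeriv ℝ (z.length + 1) F φ (fun i => e ((a :: z).get i))
      rw [iteratedFDeriv_succ_apply_left]
      rfl

/-- The coefficient family `z ↦ F_z(φ)` of `F ∈ 𝒩` at the field `φ`. [folklore] -/
def coeffFamily (e : Ξ → E) (F : E → ℝ) (φ : E) : List Ξ → ℝ := fun z => coeff e z F φ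

/-- The coefficient family of a product is the `⋆` product of the coefficient families. [folklore]
-/
theorem coeffFamily_mul (e : Ξ → E) {F G : E → ℝ} (hF : ContDiff ℝ ∞ F) (hG : ContDiff ℝ ∞ G)
    (φ : E) : coeffFamily e (fun ψ => F ψ * G ψ) φ = star (coeffFamily e F φ) (coeffFamily e G φ) := by
  funext z
  simp only [coeffFamily, coeff_mul e hF hG z, star]

/-- `(F + G)_z = F_z + G_z`. [folklore] -/
theorem coeff_add (e : Ξ → E) {F G : E → ℝ} (hF : ContDiff ℝ ∞ F) (hG : ContDiff ℝ ∞ G) :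
    ∀ z : List Ξ, coeff e z (fun ψ => F ψ + G ψ) = fun ψ => coeff e z F ψ + coeff e z G ψ
  | [] => rfl
  | a :: z => by
      rw [coeff_cons, coeff_add e hF hG z, dirDeriv_add _
        (differentiable_of_contDiff (contDiff_coeff e hF z))
        (differentiable_of_contDiff (contDiff_coeff e hG z))]
      rfl

/-- The coefficient family of a sum is the sum of the coefficient families. [folklore] -/
theorem coeffFamily_add (e : Ξ → E) {F G : E → ℝ} (hF : ContDiff ℝ ∞ F) (hG : ContDiff ℝ ∞ G)
    (φ : E) : coeffFamily e (fun ψ => F ψ + G ψ) φ =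
      fun z => coeffFamily e F φ z + coeffFamily e G φ z := by
  funext z
  simp only [coeffFamily, coeff_add e hF hG z]

variable [Fintype Ξ]

/-- The **`T_φ` pairing** `⟨F, g⟩_φ = Σ_{|z| ≤ p_𝒩} (1/z!) F_z(φ) g_z` of `F ∈ 𝒩` with a test
function. [cite: BrydgesSlade2015RGI, Definition 3.4.1] [cite: Slade2017, §6.2.2 (display (6.31) area: ⟨F,g⟩_φ)] -/
def TphiPairing (pN : ℕ) (e : Ξ → E) (F : E → ℝ) (φ : E) (g : List Ξ → ℝ) : ℝ :=
  pairing pN (coeffFamily e F φ) g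

/-- The **`T_φ` seminorm** `‖F‖_{T_φ} = sup_{g ∈ B(Φ)} |⟨F, g⟩_φ|` of `F ∈ 𝒩`, relative to the
family `𝓛` of test functionals defining the unit ball `B(Φ)` of test functions.
[cite: BrydgesSlade2015RGI, Definition 3.4.1] [cite: Slade2017, §6.2.2 (definition of the T_{φ,j}(𝔥) seminorm)] -/
def TphiNorm (pN : ℕ) (𝓛 : Set (TestFunctional Ξ)) (e : Ξ → E) (F : E → ℝ) (φ : E) : ℝ :=
  Tnorm pN 𝓛 (coeffFamily e F φ)

/-- **Brydges–Slade, Proposition 3.4.5 (product property of the `T_φ` seminorm), bosonic case:**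
for `F, G ∈ 𝒩` (smooth functions of the field), `‖FG‖_{T_φ} ≤ ‖F‖_{T_φ} ‖G‖_{T_φ}` — for every
family of test functionals with the shuffle property and unit ball bounded on short sequences (as
the lattice norms `Φ_j(𝔥_j)` are). Proof as printed: the coefficient map is an algebra
homomorphism `𝒩 → (𝓕, ⋆)` intertwining `T_φ` with `T` (`coeff_mul`), and `T` has the product
property (Proposition 5.1.2, `Tnorm_star_le`). [cite: BrydgesSlade2015RGI, Proposition 3.4.5 and its proof in §5.1] -/
theorem TphiNorm_mul_le {pN : ℕ} {𝓛 : Set (TestFunctional Ξ)} {C : ℕ → ℝ}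
    (hSH : ShuffleCompat pN 𝓛) (hC : EvalBound pN 𝓛 C) (e : Ξ → E) {F G : E → ℝ}
    (hF : ContDiff ℝ ∞ F) (hG : ContDiff ℝ ∞ G) (φ : E) :
    TphiNorm pN 𝓛 e (fun ψ => F ψ * G ψ) φ ≤ TphiNorm pN 𝓛 e F φ * TphiNorm pN 𝓛 e G φ := by
  unfold TphiNorm
  rw [coeffFamily_mul e hF hG]
  exact Tnorm_star_le hSH hC _ _

/-- `|⟨F, g⟩_φ| ≤ ‖F‖_{T_φ}` for `g ∈ B(Φ)`. [folklore] -/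
theorem abs_TphiPairing_le {pN : ℕ} {𝓛 : Set (TestFunctional Ξ)} {C : ℕ → ℝ}
    (hC : EvalBound pN 𝓛 C) (e : Ξ → E) (F : E → ℝ) (φ : E) {g : List Ξ → ℝ}
    (hg : g ∈ ball pN 𝓛) : |TphiPairing pN e F φ g| ≤ TphiNorm pN 𝓛 e F φ :=
  abs_pairing_le_Tnorm hC _ hg

/-- `|F(φ)| ≤ ‖F‖_{T_φ}` (the empty-sequence part of the pairing), whenever the indicator of the
empty sequence is an admissible test function. [cite: BrydgesSlade2015RGI, §3.4] [cite: Slade2017, §8.1 (proof of Corollary 8.1.6: "|F(0)| ≤ ‖F‖_{T_{0,N}}")] -/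
theorem abs_apply_le_TphiNorm {pN : ℕ} {𝓛 : Set (TestFunctional Ξ)} {C : ℕ → ℝ}
    (hC : EvalBound pN 𝓛 C) (h1 : (fun z : List Ξ => if z = [] then (1 : ℝ) else 0) ∈ ball pN 𝓛)
    (e : Ξ → E) (F : E → ℝ) (φ : E) : |F φ| ≤ TphiNorm pN 𝓛 e F φ :=
  abs_nil_le_Tnorm hC h1 (coeffFamily e F φ)

/-- Subadditivity of the `T_φ` seminorm. [folklore] -/
theorem TphiNorm_add_le {pN : ℕ} {𝓛 : Set (TestFunctional Ξ)} {C : ℕ → ℝ}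
    (hC : EvalBound pN 𝓛 C) (e : Ξ → E) {F G : E → ℝ} (hF : ContDiff ℝ ∞ F) (hG : ContDiff ℝ ∞ G)
    (φ : E) : TphiNorm pN 𝓛 e (fun ψ => F ψ + G ψ) φ ≤ TphiNorm pN 𝓛 e F φ + TphiNorm pN 𝓛 e G φ := by
  unfold TphiNorm
  rw [coeffFamily_add e hF hG]
  exact Tnorm_add_le hC _ _

/-- `0 ≤ ‖F‖_{T_φ}`. [folklore] -/
theorem TphiNorm_nonneg (pN : ℕ) (𝓛 : Set (TestFunctional Ξ)) (e : Ξ → E) (F : E → ℝ) (φ : E) :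
    0 ≤ TphiNorm pN 𝓛 e F φ :=
  Tnorm_nonneg _ _ _

end calculus

end Tphi

end LongRangePhi4

end Literature.Barriers.CriticalPhenomena

end
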